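import Literature.NumberTheory.Automorphic.Liu2021.Def45Polarisation
import Literature.NumberTheory.Automorphic.Liu2021.Prop46NonemptyOfCasselmanUniformizers
import HarnessLib

/-!
# [Liu 2021] Definition 4.5 (2), third bullet — the ample normalisation, and Prop. 4.6 (1) polarised with the unit clause discharged

Sequel (theorems only; no definition, no named fact) of `Liu2021/Def45Polarisation` (p318471): there the THIRD BULLET of
[Liu2021] Def. 4.5 (2) (TeX l. 1955, «`λ_μ : A_μ → A_μ^∨` is a polarization satisfying `λ ∘ i_μ(x) = i_μ(x̄)^∨ ∘ λ` for every
`x ∈ M_μ`») was typed REAL as `Def45.IsPolarisationClass τ₀ A i θ₂` — (a) `θ₂` a rational algebraic class, (b) SOME NON-ZERO real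
multiple of `θ₂ ⊗ 1` Kähler, (c) the Rosati relation on `H¹` — and supplied at every structure of CM type; and [Liu2021]
Prop. 4.6 (1) «`𝒜(μ)` is nonempty» (l. 1969) was derived over the carrier `Carriers.ofPolDR μ (PolDR σ hμ R)` as
`nonempty_cmDatum_polarised_of_casselman (h21) (hu) (hπ) (R) (hR)`.

* §1 **Ample normalisation.**  Clause (b) is the tree's currency for a polarisation class «up to sign» (as in
  `Deligne1982.…_of_isKaehlerClass_smul`, `RosatiPolarizationCM`); a printed polarization is AMPLE, i.e. on the POSITIVE ray.
  `IsPolarisationClass.neg`: the predicate is stable under `θ₂ ↦ -θ₂` (clauses (a), (c) are sign-blind: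
  `polarizationPairingOne_smul`); hence `IsPolarisationClass.exists_pos`: every `IsPolarisationClass` yields a class `θ₂' = ±θ₂`
  satisfying bullet 3 with a POSITIVE real multiple Kähler — an honest polarisation class ([LangeBirkenhake1992] §4.1:
  a polarization is the first Chern class of an ample line bundle; Kodaira: ample ⟺ positive); `not_isPolarisationClass_zero`:
  the degenerate witness `θ₂ = 0` (for which (a), (c) hold trivially) is EXCLUDED by (b) (`IsKaehlerClass.ne_zero`).
* §2 **The local-unit clause discharged.**  `nonempty_cmDatum_polarised_of_casselman_of_uniformizers (h21) (hπ) (R) (hR)`: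
  the polarised Prop. 4.6 (1) with b25's `hu` ((19.10b) at local units) PROVED by his `exists_unit_muAlg_localComponent`
  (`Prop46NonemptyOfCasselmanUnits`, p315281) — remaining: the cite `h21` ([Shimura1998] Thm. 21.4), the uniformiser clause
  `hπ` (b25's sequel `…Uniformizers`, to be composed here by append when it lands) and the de Rham token `hR` (bullet 4, l. 1957).

HONEST SCOPE.  Nothing here constructs Liu's `X_K`, `A_K`, `Ω(μ)` or touches `hM`; HC_CM is NOT proved.  Reading of bullet 3 as in
`Def45Polarisation` (READING P-R1: the cohomology-class shadow on `A_μ ⊗_{E,σ} ℂ` of the printed `E`-rational `λ_μ`; `E`-rationality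
and the isogeny-to-the-dual packaging are not tracked — as a component of a display's HYPOTHESIS `hObj` this is class ≤ print, and
[Liu2021] Thm. 4.18's main isomorphism and item (1) do not read `λ_μ`, which enters Def. 4.5 (3) and Prop. 4.6 (2) only).
THE TOKEN `R` (bullet 4, l. 1957): `r_μ : M_μ ⊗_ℚ E → H_1^{dR}(A_μ/E)` is a RIGIDIFICATION, not consumed by [Liu2021] Thm. 4.18 (1)
(statement l. 2232–2245, first proof line l. 2248: only `(A_μ, i_μ)` are read; `Def45AsPrinted` module docstring «NOT consumed by
any cell theorem»); its carrier would be algebraic de Rham `H_1` over the number field `E` with the `λ`-pairing — absent from the tree;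
so `R` stays a DECLARED ⟨CARRIER⟩ token with `hR : ∀ A i, Nonempty (R A i)` displayed by every consumer.  Liu l. 1982: «The existence of
`r_μ` is obvious» — not used as a justification here (pub-hodgecm2 s2crux-idea-1 ROUTES §18: the normalisation `β ∈ M_μ` is a norm-class
condition, trivial when `E ↪ M_μ`, undecided in general).

## References
* [Liu2021] Y. Liu, Camb. J. Math. 9 (2021) = arXiv:2102.11518 — Def. 4.5 (2) (TeX ll. 1944–1958), Prop. 4.6 (1) (l. 1969,
  proof ll. 1975–1984).
* [Shimura1998] G. Shimura, *Abelian Varieties with Complex Multiplication and Modular Functions* (1998), §6.2 Thm. 4 (3),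
  Prop. 19.10 (19.10b), §21.4 Thm. 21.4.
* [LangeBirkenhake1992] Ch. Birkenhake, H. Lange, *Complex Abelian Varieties*, §4.1 (polarizations) and Lemma 1.1.17.
-/

set_option autoImplicit false

noncomputable section

open scoped TensorProduct NumberField ComplexConjugate
open CategoryTheory IsDedekindDomain NumberField
open Literature.AlgebraicGeometry.Motives Literature.AlgebraicGeometry.HodgeTheory
open Literature.AlgebraicGeometry.ComplexMultiplication
open Literature.NumberTheory.ComplexMultiplication
open Literature.NumberTheory.GaloisRepresentations
open Literature.AlgebraicTopology.SingularHomology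
open Literature.Geometry.Kaehler
open Literature.NumberTheory.Automorphic (PicardCM.ratAlgebraicClasses PicardCM.mem_ratAlgebraicClasses_iff)

namespace Literature.NumberTheory.Automorphic.Liu2021.Def45

/-! ## §1 Sign normalisation: an honest polarisation (POSITIVE Kähler multiple) inside every `IsPolarisationClass` -/

section Sign

variable {k : Type} [Field k] [Algebra k ℂ] {K : Type} [Field K] [NumberField K]
  {τ₀ : K →+* ℂ} {A : AbelianVariety k} {i : K →+* A.endAlgebra} {θ₂ : bettiCohomology (A.baseChange ℂ).X 2}

/-- `IsPolarisationClass` is stable under `θ₂ ↦ -θ₂`: the algebraic classes form a subgroup, `(-s) • (-θ₂ ⊗ 1) = s • θ₂ ⊗ 1`,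
and `Q_{-θ₂} = (-1)^{dim A - 1} Q_{θ₂}` on both sides of the Rosati relation (`polarizationPairingOne_smul`).  (Clause (b)
«Kähler up to a non-zero real scalar» is the tree's currency for a polarisation class up to sign, cf.
`Deligne1982.…_of_isKaehlerClass_smul`.) [cite: Liu2021, Def. 4.5 (2) (TeX l. 1955)] [cite: LangeBirkenhake1992, Lemma 1.1.17] -/
theorem IsPolarisationClass.neg (h : IsPolarisationClass τ₀ A i θ₂) : IsPolarisationClass τ₀ A i (-θ₂) := by
  obtain ⟨halg, ⟨s, hs, hK⟩, hros⟩ := h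
  have hneg : ofRatClass (ComplexPoints (A.baseChange ℂ).X) 2 (-θ₂) =
      (-1 : ℂ) • ofRatClass (ComplexPoints (A.baseChange ℂ).X) 2 θ₂ := by
    rw [map_neg, neg_one_smul]
  refine ⟨Submodule.neg_mem _ halg, ⟨-s, neg_ne_zero.mpr hs, ?_⟩, fun x xc hxc u v => ?_⟩
  · rw [hneg, smul_smul, Complex.ofReal_neg, neg_mul_neg, mul_one]; exact hK
  · rw [hneg, polarizationPairingOne_smul, polarizationPairingOne_smul, hros x xc hxc u v]

/-- **The ample normalisation.**  Every `IsPolarisationClass` contains an honest polarisation class: some `θ₂'` (`= ±θ₂`)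
satisfying bullet 3 whose complexification has a POSITIVE real multiple which is a Kähler class (so `θ₂'` lies on the
ray of an ample class — Kodaira).  [cite: Liu2021, Def. 4.5 (2) (TeX l. 1955)] [cite: LangeBirkenhake1992, §4.1 and Lemma 1.1.17] -/
theorem IsPolarisationClass.exists_pos (h : IsPolarisationClass τ₀ A i θ₂) :
    ∃ θ₂' : bettiCohomology (A.baseChange ℂ).X 2, IsPolarisationClass τ₀ A i θ₂' ∧
      ∃ s : ℝ, 0 < s ∧
        IsKaehlerClass (A.baseChange ℂ).dim (A.baseChange ℂ).X
          ((s : ℂ) • ofRatClass (ComplexPoints (A.baseChange ℂ).X) 2 θ₂') := by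
  obtain ⟨s, hs, hK⟩ := h.2.1
  rcases lt_or_gt_of_ne hs with hlt | hgt
  · refine ⟨-θ₂, h.neg, -s, neg_pos.mpr hlt, ?_⟩
    rwa [map_neg, smul_neg, Complex.ofReal_neg, neg_smul, neg_neg]
  · exact ⟨θ₂, h, s, hgt, hK⟩

/-- **Non-vacuity of clause (b)**: the ZERO class is not a polarisation class in the sense of `IsPolarisationClass` (a Kähler
class on a smooth projective variety of dimension `≥ 1` is non-zero, `IsKaehlerClass.ne_zero`, Voisin I Cor. 3.9) — so the
predicate is not satisfied by the degenerate witness `θ₂ = 0`, for which clauses (a) and (c) hold trivially.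
[cite: VoisinHodgeI2002, §3.1.3 Cor. 3.9] [cite: Liu2021, Def. 4.5 (2) (TeX l. 1955)] -/
theorem not_isPolarisationClass_zero (hdim : 1 ≤ (A.baseChange ℂ).dim) : ¬ IsPolarisationClass τ₀ A i 0 := by
  rintro ⟨-, ⟨s, -, hK⟩, -⟩
  rw [map_zero, smul_zero] at hK
  exact hK.ne_zero AbelianVariety.isSmoothProjective_holds hdim rfl

/-- **Supply in the ample normalisation**: every structure `(A₀, ι₀)` of CM type `(K, Φ)` over `k ⊆ ℂ`, with rational
extension `i`, carries a class `θ₂` satisfying bullet 3 AND with a POSITIVE real multiple of `θ₂ ⊗ 1` Kähler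
(`exists_isPolarisationClass_of_isCMTypeRealisationOver` + `IsPolarisationClass.exists_pos`).
[cite: Liu2021, proof of Prop. 4.6 (1) (TeX ll. 1982–1984)] [cite: Shimura1998, §6.2 Theorem 4 (3)] -/
theorem exists_isPolarisationClass_pos_of_isCMTypeRealisationOver [IsCMField K] (τ₀ : K →+* ℂ) {Φ : CMType K}
    {A₀ : AbelianVariety k} {ι₀ : 𝓞 K →+* End A₀} (hA : IsCMTypeRealisationOver Φ A₀ ι₀)
    {i : K →+* A₀.endAlgebra} (hi : ∀ a : 𝓞 K, i (algebraMap (𝓞 K) K a) = AbelianVariety.endAlgebra.of A₀ (ι₀ a)) :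
    ∃ θ₂ : bettiCohomology (A₀.baseChange ℂ).X 2, IsPolarisationClass τ₀ A₀ i θ₂ ∧
      ∃ s : ℝ, 0 < s ∧
        IsKaehlerClass (A₀.baseChange ℂ).dim (A₀.baseChange ℂ).X
          ((s : ℂ) • ofRatClass (ComplexPoints (A₀.baseChange ℂ).X) 2 θ₂) := by
  obtain ⟨θ₂, hθ₂⟩ := exists_isPolarisationClass_of_isCMTypeRealisationOver τ₀ hA hi
  exact hθ₂.exists_pos

end Sign

/-! ## §2 Prop. 4.6 (1) over the polarised carrier, the local-unit clause of (19.10b) discharged -/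

section Main

variable {F : Type} [Field F] [NumberField F] [IsCMField F] [IsGalois ℚ F] (σ : F →+* ℂ)
  {μ : IdeleClassGroup F →ₜ* Circle} (hμ : IdeleClassGroup.IsConjugateSymplectic F μ)
  (hw : IdeleClassGroup.HasWeight F μ 1)

/-- **[Liu2021, Prop. 4.6 (1)] «`𝒜(μ)` is nonempty» over the POLARISED carrier, local-unit clause PROVED.**  For a CM field
`F` Galois over `ℚ`, a pin `σ : F → ℂ`, `μ` conjugate symplectic of weight one: GIVEN the cite `h21` ([Shimura1998] Thm. 21.4
= Casselman's theorem), the uniformiser clause `hπ` of (19.10b) for `μ^{alg}` (b25's display, verbatim) and an inhabitant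
`hR` of the de Rham token `R` (bullet 4, l. 1957), there is a CM datum over `Carriers.ofPolDR μ (PolDR σ hμ R)` — bullets 1–3
REAL (bullet 3 supplied by `exists_isPolarisationClass_of_isCMTypeRealisationOver`), the unit clause `hu` of
`nonempty_cmDatum_polarised_of_casselman` discharged by b25's `exists_unit_muAlg_localComponent`.
[cite: Liu2021, Prop. 4.6 (1) (TeX l. 1969) and its proof (ll. 1975–1984); Def. 4.5 (2) (l. 1955)]
[cite: Shimura1998, §21.4 Thm. 21.4, Prop. 19.10 (19.10b) and §6.2 Theorem 4 (3)] -/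
theorem nonempty_cmDatum_polarised_of_casselman_of_uniformizers (h21 : shimura1998_thm21_4_casselman)
    (hπ : haveI := hμ.numberField_muAlgValueField
      ∀ v : HeightOneSpectrum (𝓞 F), ∃ π : 𝓞 (IdeleClassGroup.muAlgValueField F μ),
        (IdeleClassGroup.muAlg F μ).valueAtUniformizer v =
            (IdeleClassGroup.muAlgValueField F μ).subtype (π : IdeleClassGroup.muAlgValueField F μ) ∧
          ∀ (L : Type) [Field L] [NumberField L] [Normal ℚ L] (ιL : L →+* ℂ)
            (j : IdeleClassGroup.muAlgValueField F μ →+* L) (σL : F →+* L), ιL.comp σL = σ →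
            IsReflexTypeNorm
              (valuedIn ιL (inducedCMType (incl (AlgHom.id ℚ F) σ hμ) (reflexCMType σ hμ.cmType (AlgHom.id ℚ F))).1)
              j σL v.asIdeal (Ideal.span {π}))
    (R : ∀ A : AbelianVariety F, (IdeleClassGroup.muAlgValueField F μ →+* A.endAlgebra) → Type)
    (hR : ∀ A i, Nonempty (R A i)) :
    Nonempty (CMDatum (AlgHom.id ℚ F) σ hμ hw (Carriers.ofPolDR μ (PolDR σ hμ R))) :=
  nonempty_cmDatum_polarised_of_casselman σ hμ hw h21 (fun v u => exists_unit_muAlg_localComponent v u) hπ R hR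

end Main


/-! ## §3 Prop. 4.6 (1) over the polarised carrier with BOTH (19.10b) clauses discharged (appended after b25's (V) p317180 ✔) -/

section Primed

variable {F : Type} [Field F] [NumberField F] [IsCMField F] [IsGalois ℚ F] (σ : F →+* ℂ)
  {μ : IdeleClassGroup F →ₜ* Circle} (hμ : IdeleClassGroup.IsConjugateSymplectic F μ)
  (hw : IdeleClassGroup.HasWeight F μ 1)

/-- **Supply-parametric Prop. 4.6 (1) with NO hypothesis on `μ`**: `nonempty_cmDatum_of_casselman_of_supply` with b25's two
dischargers plugged in — `hu` by `exists_unit_muAlg_localComponent` (p315281) and `hπ` by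
`exists_integer_valueAtUniformizer_isReflexTypeNorm` (p317180, the Shimura–Taniyama factorisation of `μ^{alg}(ϖ_v)`): GIVEN the
cite `h21` ([Shimura1998] Thm. 21.4) and a supply `hP` of the `(λ_μ, r_μ)`-carrier at every integral structure of CM type `Ψ̃_μ`
over `F` with its rational extension, there is a CM datum over `Carriers.ofPolDR μ P`.
[cite: Liu2021, Prop. 4.6 (1) (TeX l. 1969) and its proof (ll. 1975–1984)] [cite: Shimura1998, §21.4 Thm. 21.4 and Prop. 19.10 (19.10b)] -/
theorem nonempty_cmDatum_of_casselman_of_supply' (h21 : shimura1998_thm21_4_casselman)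
    (P : ∀ A : AbelianVariety F, (IdeleClassGroup.muAlgValueField F μ →+* A.endAlgebra) → Type)
    (hP : letI : Algebra F ℂ := σ.toAlgebra
      haveI := hμ.numberField_muAlgValueField
      ∀ (A : AbelianVariety F) (ι₀ : 𝓞 (IdeleClassGroup.muAlgValueField F μ) →+* End A)
        (i : IdeleClassGroup.muAlgValueField F μ →+* A.endAlgebra),
        (∀ a, i (algebraMap _ (IdeleClassGroup.muAlgValueField F μ) a) = AbelianVariety.endAlgebra.of A (ι₀ a)) →
        IsCMTypeRealisationOver
          (inducedCMType (incl (AlgHom.id ℚ F) σ hμ) (reflexCMType σ hμ.cmType (AlgHom.id ℚ F))) A ι₀ →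
        Nonempty (P A i)) :
    Nonempty (CMDatum (AlgHom.id ℚ F) σ hμ hw (Carriers.ofPolDR μ P)) :=
  nonempty_cmDatum_of_casselman_of_supply σ hμ hw h21 (fun v u => exists_unit_muAlg_localComponent v u)
    (fun v => exists_integer_valueAtUniformizer_isReflexTypeNorm σ hμ hw v) P hP

/-- **[Liu2021, Prop. 4.6 (1)] «`𝒜(μ)` is nonempty» with bullets 1–3 REAL and NO hypothesis on `μ`.**  For a CM field `F`
Galois over `ℚ`, a pin `σ : F → ℂ`, `μ` conjugate symplectic of weight one: GIVEN ONLY the cite `h21` ([Shimura1998] Thm. 21.4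
= Casselman's theorem, [Shi71] Thm. 6) and an inhabitant `hR` of the de Rham token `R` (bullet 4, l. 1957), there is a CM datum
`D_μ = (A_μ, i_μ, λ_μ, r_μ)` over `Carriers.ofPolDR μ (PolDR σ hμ R)` — bullet 1 (`det45`), bullet 2 (`IsCMCharacterMuAlgHecke`)
and bullet 3 (`IsPolarisationClass`, [Shi71] Thm. 5 / [Shimura1998] §6.2 Thm. 4 (3)) PROVED; (19.10b) discharged by b25's
(U) p315281 and (V) p317180.  This is b25's `nonempty_cmDatum_of_casselman'` with the token `P` SPECIALISED to the polarised
carrier and `hP` REDUCED to `hR`. [cite: Liu2021, Prop. 4.6 (1) (TeX l. 1969) and its proof (ll. 1975–1984); Def. 4.5 (2) (l. 1955)]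
[cite: Shimura1998, §21.4 Thm. 21.4 and §6.2 Theorem 4 (3)] [cite: Shimura1971ZetaCM, Theorem 5 and Theorem 6] -/
theorem nonempty_cmDatum_polarised_of_casselman' (h21 : shimura1998_thm21_4_casselman)
    (R : ∀ A : AbelianVariety F, (IdeleClassGroup.muAlgValueField F μ →+* A.endAlgebra) → Type)
    (hR : ∀ A i, Nonempty (R A i)) :
    Nonempty (CMDatum (AlgHom.id ℚ F) σ hμ hw (Carriers.ofPolDR μ (PolDR σ hμ R))) :=
  nonempty_cmDatum_polarised_of_casselman_of_uniformizers σ hμ hw h21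
    (fun v => exists_integer_valueAtUniformizer_isReflexTypeNorm σ hμ hw v) R hR

end Primed

end Literature.NumberTheory.Automorphic.Liu2021.Def45

end
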